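import Summits.CriticalPhenomena.PercolationContinuityZ3.Theorems.PercNearOneGluingNoHeavyLowerTailSahiCombTriWDiamondKernel

/-!
# The diamond kernel lemma inside an up-set `P`

Support file of the one-cut programme (crux `NoHeavyLowerTail`, stmt-CriticalPhenomena-4575; cell `prim-masterthm`, seat P5 gen 29).
`…TriWDiamondKernel` proves the kernel lemma of design P2 at `P = ⊤`; here it is restricted to an arbitrary up-set `P` (the restriction is free: a demand
`s ∈ P` only sees supplies `t ⊇ s`, which lie in `P`).  The supports are literally the eleven summands of the diamond demand count, the equations live on
the eight supply blocks `P ∩ F₁ ∩ G₁` (twice), `P ∩ F₀ ∩ G₀` (twice), `P ∩ Fp ∩ Gp` (twice), `P ∩ Fq ∩ Gq` (twice).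

* **`FiveUpSet.diamond_kernel_eq_zero_of_upperSet`**.
HONEST LABEL: elementary linear algebra over `ℚ` (std axioms). [this work]
-/

namespace Summit.CriticalPhenomena.PercolationContinuityZ3.Theorems

namespace FiveUpSet

open Finset

variable {α : Type} [DecidableEq α] [Fintype α]

/-- **Diamond Hall, kernel form inside an up-set `P`** (design P2). [this work] -/
theorem diamond_kernel_eq_zero_of_upperSet (P F₀ Fp Fq F₁ G₀ Gp Gq G₁ : Finset (Finset α))
    (hP : IsUpperSet (P : Set (Finset α)))
    (hF₀ : IsUpperSet (F₀ : Set (Finset α))) (hFp : IsUpperSet (Fp : Set (Finset α)))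
    (hFq : IsUpperSet (Fq : Set (Finset α))) (hF₁ : IsUpperSet (F₁ : Set (Finset α)))
    (hG₀ : IsUpperSet (G₀ : Set (Finset α))) (hGp : IsUpperSet (Gp : Set (Finset α)))
    (hGq : IsUpperSet (Gq : Set (Finset α))) (hG₁ : IsUpperSet (G₁ : Set (Finset α)))
    (hF0p : F₀ ⊆ Fp) (hF0q : F₀ ⊆ Fq) (hFp1 : Fp ⊆ F₁) (hFq1 : Fq ⊆ F₁)
    (hG0p : G₀ ⊆ Gp) (hG0q : G₀ ⊆ Gq) (hGp1 : Gp ⊆ G₁) (hGq1 : Gq ⊆ G₁)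
    (ka kb kc kd ke kf kg kh ki kj kk : Finset α → ℚ)
    (hka : ∀ s, ka s ≠ 0 → s ∈ P ∧ sᶜ ∈ F₀ ∧ s ∈ G₁)
    (hkb : ∀ s, kb s ≠ 0 → s ∈ P ∧ s ∈ F₀ ∧ sᶜ ∈ G₁)
    (hkc : ∀ s, kc s ≠ 0 → s ∈ P ∧ sᶜ ∈ F₁ ∧ s ∈ G₀)
    (hkd : ∀ s, kd s ≠ 0 → s ∈ P ∧ s ∈ F₁ ∧ sᶜ ∈ G₀)
    (hke : ∀ s, ke s ≠ 0 → s ∈ P ∧ sᶜ ∈ Fp ∧ s ∈ Gq)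
    (hkf : ∀ s, kf s ≠ 0 → s ∈ P ∧ s ∈ Fp ∧ sᶜ ∈ Gq)
    (hkg : ∀ s, kg s ≠ 0 → s ∈ P ∧ sᶜ ∈ Fq ∧ s ∈ Gp)
    (hkh : ∀ s, kh s ≠ 0 → s ∈ P ∧ s ∈ Fq ∧ sᶜ ∈ Gp)
    (hki : ∀ s, ki s ≠ 0 → s ∈ P ∧ sᶜ ∈ (Fq \ Fp) ∩ (Gq \ Gp))
    (hkj : ∀ s, kj s ≠ 0 → s ∈ P ∧ sᶜ ∈ (Fp \ Fq) ∩ (Gp \ Gq))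
    (hkk : ∀ s, kk s ≠ 0 → s ∈ P ∧ sᶜ ∈ ((F₁ \ F₀) ∩ (G₁ \ G₀)) \ ((Fp \ Fq) ∩ (Gq \ Gp) ∪ (Fq \ Fp) ∩ (Gp \ Gq)))
    (h0 : ∀ t, t ∈ P → t ∈ F₁ → t ∈ G₁ → zsum kb t + zsum kc t + zsum ke t + zsum kf t + zsum kg t + zsum kh t = 0)
    (h1 : ∀ t, t ∈ P → t ∈ F₁ → t ∈ G₁ → zsum ka t + zsum kd t + zsum kf t + zsum kh t + zsum kk t = 0)
    (h2 : ∀ t, t ∈ P → t ∈ F₀ → t ∈ G₀ → zsum kd t = 0)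
    (h3 : ∀ t, t ∈ P → t ∈ F₀ → t ∈ G₀ → zsum kh t = 0)
    (h4 : ∀ t, t ∈ P → t ∈ Fp → t ∈ Gp → zsum kc t + zsum kh t = 0)
    (h5 : ∀ t, t ∈ P → t ∈ Fp → t ∈ Gp → zsum kf t + zsum kg t + zsum kj t = 0)
    (h6 : ∀ t, t ∈ P → t ∈ Fq → t ∈ Gq → zsum ke t + zsum kh t + zsum ki t = 0)
    (h7 : ∀ t, t ∈ P → t ∈ Fq → t ∈ Gq → zsum kb t + zsum kg t = 0) :
    (∀ s, ka s = 0) ∧ (∀ s, kb s = 0) ∧ (∀ s, kc s = 0) ∧ (∀ s, kd s = 0) ∧ (∀ s, ke s = 0) ∧ (∀ s, kf s = 0) ∧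
      (∀ s, kg s = 0) ∧ (∀ s, kh s = 0) ∧ (∀ s, ki s = 0) ∧ (∀ s, kj s = 0) ∧ (∀ s, kk s = 0) := by
  -- off `P` every combination vanishes (point support in `P`)
  have va : ∀ t, t ∉ P → zsum ka t = 0 := fun t ht => zsum_eq_zero_of_not_mem hP ka (fun d hd => (hka d hd).1) ht
  have vb : ∀ t, t ∉ P → zsum kb t = 0 := fun t ht => zsum_eq_zero_of_not_mem hP kb (fun d hd => (hkb d hd).1) ht
  have vc : ∀ t, t ∉ P → zsum kc t = 0 := fun t ht => zsum_eq_zero_of_not_mem hP kc (fun d hd => (hkc d hd).1) ht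
  have vd : ∀ t, t ∉ P → zsum kd t = 0 := fun t ht => zsum_eq_zero_of_not_mem hP kd (fun d hd => (hkd d hd).1) ht
  have ve : ∀ t, t ∉ P → zsum ke t = 0 := fun t ht => zsum_eq_zero_of_not_mem hP ke (fun d hd => (hke d hd).1) ht
  have vf : ∀ t, t ∉ P → zsum kf t = 0 := fun t ht => zsum_eq_zero_of_not_mem hP kf (fun d hd => (hkf d hd).1) ht
  have vg : ∀ t, t ∉ P → zsum kg t = 0 := fun t ht => zsum_eq_zero_of_not_mem hP kg (fun d hd => (hkg d hd).1) ht
  have vh : ∀ t, t ∉ P → zsum kh t = 0 := fun t ht => zsum_eq_zero_of_not_mem hP kh (fun d hd => (hkh d hd).1) ht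
  have vi : ∀ t, t ∉ P → zsum ki t = 0 := fun t ht => zsum_eq_zero_of_not_mem hP ki (fun d hd => (hki d hd).1) ht
  have vj : ∀ t, t ∉ P → zsum kj t = 0 := fun t ht => zsum_eq_zero_of_not_mem hP kj (fun d hd => (hkj d hd).1) ht
  have vk : ∀ t, t ∉ P → zsum kk t = 0 := fun t ht => zsum_eq_zero_of_not_mem hP kk (fun d hd => (hkk d hd).1) ht
  refine diamond_kernel_eq_zero F₀ Fp Fq F₁ G₀ Gp Gq G₁ hF₀ hFp hFq hF₁ hG₀ hGp hGq hG₁ hF0p hF0q hFp1 hFq1 hG0p hG0q hGp1 hGq1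
    ka kb kc kd ke kf kg kh ki kj kk (fun s hs => (hka s hs).2) (fun s hs => (hkb s hs).2) (fun s hs => (hkc s hs).2)
    (fun s hs => (hkd s hs).2) (fun s hs => (hke s hs).2) (fun s hs => (hkf s hs).2) (fun s hs => (hkg s hs).2)
    (fun s hs => (hkh s hs).2) ?_ ?_ ?_ ?_ ?_ ?_ ?_ ?_ ?_ ?_ ?_
  · intro s hs
    have h' := (hki s hs).2
    simp only [mem_inter, mem_sdiff] at h'
    exact h'
  · intro s hs
    have h' := (hkj s hs).2
    simp only [mem_inter, mem_sdiff] at h'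
    exact h'
  · intro s hs
    have h' := (hkk s hs).2
    simp only [mem_inter, mem_sdiff, mem_union] at h'
    exact h'
  · intro t htF htG
    by_cases htP : t ∈ P
    · exact h0 t htP htF htG
    · rw [vb t htP, vc t htP, ve t htP, vf t htP, vg t htP, vh t htP]; ring
  · intro t htF htG
    by_cases htP : t ∈ P
    · exact h1 t htP htF htG
    · rw [va t htP, vd t htP, vf t htP, vh t htP, vk t htP]; ring
  · intro t htF htG
    by_cases htP : t ∈ P
    · exact h2 t htP htF htG
    · exact vd t htP
  · intro t htF htG
    by_cases htP : t ∈ P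
    · exact h3 t htP htF htG
    · exact vh t htP
  · intro t htF htG
    by_cases htP : t ∈ P
    · exact h4 t htP htF htG
    · rw [vc t htP, vh t htP]; ring
  · intro t htF htG
    by_cases htP : t ∈ P
    · exact h5 t htP htF htG
    · rw [vf t htP, vg t htP, vj t htP]; ring
  · intro t htF htG
    by_cases htP : t ∈ P
    · exact h6 t htP htF htG
    · rw [ve t htP, vh t htP, vi t htP]; ring
  · intro t htF htG
    by_cases htP : t ∈ P
    · exact h7 t htP htF htG
    · rw [vb t htP, vg t htP]; ring

end FiveUpSet

end Summit.CriticalPhenomena.PercolationContinuityZ3.Theorems
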